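import Mathlib.Analysis.SpecialFunctions.Pow.Deriv
import Mathlib.Analysis.SpecialFunctions.Complex.Arg
import Mathlib.Analysis.SpecialFunctions.Exp
import Mathlib.Analysis.SpecialFunctions.Pow.Asymptotics
import Literature.NumberTheory.Transcendental.HypersurfaceCover
import Summits.Schanuel.Schanuel.Theorems.ZilberEacComplexPunctureDecouplingLemmas
import Literature.NumberTheory.Transcendental.ExpVarieties
import Literature.ModelTheory.ExponentialFields.Languages
import Summits.Schanuel.Schanuel.Theorems.ZilberEacComplexEscapeLemmas
import HarnessLib

/-!
# EC by escape to infinity over diagonal quadric bases (no lattice-direction hypothesis)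

A third mechanism for Zilber's Exponential-Algebraic Closedness in the range `dim π₁(V) = n - 1`
(first open rung, Mantova–Masser, PLMS 129 (2024), §1 p. 5), complementing the lattice-ray theorems
of this packet: for the `(s+1)`-folds

  `V = {x_{s+1} = g(x'), yⱼ = cⱼ y_{s+1} + Aⱼ(x') (j ≤ s)}`,
  `g(x') = Σᵢ aᵢ xᵢ² + Σᵢ bᵢ xᵢ + c₀`  (a DIAGONAL quadric with `α := Σᵢ aᵢ ≠ 0`),

with `cⱼ ≠ 0` and ARBITRARY polynomials `Aⱼ`, exponential points exist with ALL coordinates large: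
`xⱼ = τ + log cⱼ + ζⱼ`, `x_{s+1} = g(x') = τ - 2πiσk`, `τ = -(β(v)-1)/(2α) + √E` solving
`α τ² + (β(v) - 1) τ + (g(v) + 2πiσk) = 0` (`v = log c + ζ`), `Re τ ≥ √(πk/|α|) - O(1)`, so that
the system becomes `e^{ζⱼ} = 1 + Aⱼ(x) e^{-τ}/cⱼ` on `‖ζ‖ < 1` (contraction lemma
`Literature.NumberTheory.Transcendental.ExpDominant.exists_exp_eq_one_add`). No hypothesis on lattice
directions: e.g. `x₃ = -x₁² - x₂²` (`y₃ → ∞` along every lattice ray) with arbitrary `Aⱼ`.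

* (lemmas `principalSqrt_facts`, `exists_sign_re_nonneg`, `tendsto_one_add_pow_mul_exp_neg` in
  `ZilberEacComplexEscapeLemmas.lean`);
* `exists_expPoint_quadricEscape` — **EC for the class above**;
* `quadricEscape_inter_expGraph_nonempty` — EC vocabulary.

HONEST FRAMING: a modest new sub-rung of EAC; nothing here bears on Schanuel's conjecture.
-/

noncomputable section

open Complex MvPolynomial Metric Set Filter Topology

set_option linter.dupNamespace false

namespace Summit.Schanuel.Schanuel.Theorems

/-! ### The escape theorem -/

set_option maxHeartbeats 400000 in
/-- **EC by escape to infinity over a diagonal quadric base.** Let `a, b ∈ ℂˢ`, `c₀ ∈ ℂ` with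
`α := Σᵢ aᵢ ≠ 0`, `g(x) = Σᵢ aᵢ xᵢ² + Σᵢ bᵢ xᵢ + c₀`, let `cⱼ ∈ ℂˣ` and `Aⱼ ∈ ℂ[x₁..xₛ]` be
arbitrary. Then the system `exp xⱼ = cⱼ · e^{g(x)} + Aⱼ(x)` (`j ≤ s`) has a solution `x ∈ ℂˢ`;
i.e. the `(s+1)`-fold `V = {x_{s+1} = g(x'), yⱼ = cⱼ y_{s+1} + Aⱼ(x')}` — additive projection the
quadric hypersurface `x_{s+1} = g(x')`, `dim π₁ V = n - 1`, first open range of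
Exponential-Algebraic Closedness (Mantova–Masser 2024 §1 p. 5) — meets the graph of `exp`, with NO
hypothesis on lattice directions (in particular for bases like `x₃ = -x₁² - x₂²` where `y₃ → ∞`
along every lattice ray). Mechanism: all coordinates escape to infinity together,
`xⱼ = τ + log cⱼ + ζⱼ` with `Re τ ≍ √k → ∞`, and `e^{ζⱼ} = 1 + Aⱼ(x)e^{-τ}/cⱼ` is solved by the
contraction lemma. New. [cite: MantovaMasser2023, §1 p.5 (the open case dim π(V) = 2 in ℂ³×ℂˣ³)] -/
theorem exists_expPoint_quadricEscape {s : ℕ} (a b : Fin s → ℂ) (c₀ : ℂ) (hα : ∑ i, a i ≠ 0)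
    (c : Fin s → ℂ) (hc : ∀ j, c j ≠ 0) (A : Fin s → MvPolynomial (Fin s) ℂ) :
    ∃ x : Fin s → ℂ, ∀ j,
      exp (x j) = c j * exp (∑ i, a i * x i ^ 2 + ∑ i, b i * x i + c₀) + eval x (A j) := by
  classical
  set α : ℂ := ∑ i, a i with hαdef
  set g : (Fin s → ℂ) → ℂ := fun x => ∑ i, a i * x i ^ 2 + ∑ i, b i * x i + c₀ with hgdef
  set ℓ : Fin s → ℂ := fun j => log (c j) with hℓ
  have hexpℓ : ∀ j, exp (ℓ j) = c j := fun j => Complex.exp_log (hc j)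
  obtain ⟨σ, hσ, hσre⟩ := exists_sign_re_nonneg α
  set Dσ : ℂ := -(I * σ) / α with hDσ
  have hσabs : |σ| = 1 := by rcases hσ with h | h <;> simp [h]
  have hDσnorm : ‖Dσ‖ = ‖α‖⁻¹ := by
    rw [hDσ, norm_div, norm_neg, norm_mul, Complex.norm_I, Complex.norm_real, Real.norm_eq_abs,
      hσabs, one_mul, one_div]
  have hα0 : 0 < ‖α‖ := norm_pos_iff.mpr hα
  have hDσpos : 0 < ‖Dσ‖ := by rw [hDσnorm]; positivity
  have hgrowth := fun j =>
    Literature.NumberTheory.Transcendental.HypersurfaceCover.exists_norm_eval_le_pow (A j)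
  choose CA hCA NA hCNA using hgrowth
  -- ### the algebraic branch: `v = ℓ + ζ`, `β(v) = 2 Σ aᵢ vᵢ + Σ bᵢ`, `τ = -(β-1)/(2α) + E^{1/2}`
  set βf : (Fin s → ℂ) → ℂ := fun v => 2 * ∑ i, a i * v i + ∑ i, b i with hβf
  obtain ⟨B, hB0, hB⟩ : ∃ B : ℝ, 0 ≤ B ∧ ∀ ζ : Fin s → ℂ, ‖ζ‖ ≤ 1 →
      ‖(βf (ℓ + ζ) - 1) / (2 * α)‖ ≤ B ∧ ‖((βf (ℓ + ζ) - 1) / (2 * α)) ^ 2 - g (ℓ + ζ) / α‖ ≤ B ∧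
        ‖ℓ + ζ‖ ≤ B := by
    have hcont1 : Continuous fun ζ : Fin s → ℂ => (βf (ℓ + ζ) - 1) / (2 * α) := by
      simp only [hβf]; fun_prop
    have hcont2 : Continuous fun ζ : Fin s → ℂ =>
        ((βf (ℓ + ζ) - 1) / (2 * α)) ^ 2 - g (ℓ + ζ) / α := by
      simp only [hβf, hgdef]; fun_prop
    obtain ⟨B₁, hB₁⟩ := (isCompact_closedBall (0 : Fin s → ℂ) 1).exists_bound_of_continuousOn
      hcont1.continuousOn
    obtain ⟨B₂, hB₂⟩ := (isCompact_closedBall (0 : Fin s → ℂ) 1).exists_bound_of_continuousOn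
      hcont2.continuousOn
    refine ⟨max (max B₁ B₂) (‖ℓ‖ + 1), by positivity, fun ζ hζ => ⟨?_, ?_, ?_⟩⟩
    · exact (hB₁ ζ (by rwa [mem_closedBall, dist_zero_right])).trans
        ((le_max_left _ _).trans (le_max_left _ _))
    · exact (hB₂ ζ (by rwa [mem_closedBall, dist_zero_right])).trans
        ((le_max_right _ _).trans (le_max_left _ _))
    · exact ((norm_add_le _ _).trans (by linarith)).trans (le_max_right _ _)
  -- ### choice of `k`: `CA j (2 + 3B + 2√((2π‖Dσ‖+1)k))^{NA j} e^{-(√(π‖Dσ‖k) - B - 1)} / ‖c j‖ ≤ ε`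
  have hε : (0 : ℝ) < 1 / (16 * ((s : ℝ) + 1)) := by positivity
  have hsmall : ∀ j, ∀ᶠ k : ℕ in atTop,
      CA j / ‖c j‖ * (2 + 3 * B + 2 * Real.sqrt ((2 * Real.pi * ‖Dσ‖ + 1) * k)) ^ NA j *
        Real.exp (-(Real.sqrt (Real.pi * ‖Dσ‖ * k) - B - 1)) ≤ 1 / (16 * ((s : ℝ) + 1)) := by
    intro j
    have hu : Tendsto (fun k : ℕ => Real.sqrt (Real.pi * ‖Dσ‖ * k)) atTop atTop := by
      refine Real.tendsto_sqrt_atTop.comp ?_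
      exact tendsto_natCast_atTop_atTop.const_mul_atTop (by positivity)
    set L : ℝ := 2 + 3 * B + 2 * Real.sqrt ((2 * Real.pi * ‖Dσ‖ + 1) / (Real.pi * ‖Dσ‖)) with hL
    have hL0 : 0 ≤ L := by positivity
    have hdom : ∀ k : ℕ, 2 + 3 * B + 2 * Real.sqrt ((2 * Real.pi * ‖Dσ‖ + 1) * k) ≤
        L * (1 + Real.sqrt (Real.pi * ‖Dσ‖ * k)) := by
      intro k
      have h1 : Real.sqrt ((2 * Real.pi * ‖Dσ‖ + 1) * k) =
          Real.sqrt ((2 * Real.pi * ‖Dσ‖ + 1) / (Real.pi * ‖Dσ‖)) * Real.sqrt (Real.pi * ‖Dσ‖ * k) := by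
        rw [← Real.sqrt_mul (by positivity)]
        congr 1
        field_simp
      rw [h1, hL]
      have := Real.sqrt_nonneg ((2 * Real.pi * ‖Dσ‖ + 1) / (Real.pi * ‖Dσ‖))
      have := Real.sqrt_nonneg (Real.pi * ‖Dσ‖ * k)
      nlinarith
    have hlim := tendsto_one_add_pow_mul_exp_neg (NA j)
    have hlim2 : Tendsto (fun k : ℕ => CA j / ‖c j‖ * L ^ NA j * Real.exp (B + 1) *
        ((1 + Real.sqrt (Real.pi * ‖Dσ‖ * k)) ^ NA j *
          Real.exp (-Real.sqrt (Real.pi * ‖Dσ‖ * k)))) atTop (𝓝 0) := by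
      have := (hlim.comp hu).const_mul (CA j / ‖c j‖ * L ^ NA j * Real.exp (B + 1))
      rw [mul_zero] at this
      exact this
    refine (hlim2.eventually (eventually_le_nhds hε)).mono fun k hk => le_trans ?_ hk
    have hcj : 0 < ‖c j‖ := norm_pos_iff.mpr (hc j)
    have h1 : (2 + 3 * B + 2 * Real.sqrt ((2 * Real.pi * ‖Dσ‖ + 1) * k)) ^ NA j ≤
        (L * (1 + Real.sqrt (Real.pi * ‖Dσ‖ * k))) ^ NA j :=
      pow_le_pow_left₀ (by positivity) (hdom k) _
    have h2 : Real.exp (-(Real.sqrt (Real.pi * ‖Dσ‖ * k) - B - 1)) =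
        Real.exp (B + 1) * Real.exp (-Real.sqrt (Real.pi * ‖Dσ‖ * k)) := by
      rw [← Real.exp_add]; ring_nf
    rw [h2, mul_pow] at *
    have hCA' : 0 ≤ CA j / ‖c j‖ := div_nonneg (hCA j) (norm_nonneg _)
    calc CA j / ‖c j‖ * (2 + 3 * B + 2 * Real.sqrt ((2 * Real.pi * ‖Dσ‖ + 1) * k)) ^ NA j *
          (Real.exp (B + 1) * Real.exp (-Real.sqrt (Real.pi * ‖Dσ‖ * k)))
        ≤ CA j / ‖c j‖ * (L ^ NA j * (1 + Real.sqrt (Real.pi * ‖Dσ‖ * k)) ^ NA j) *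
          (Real.exp (B + 1) * Real.exp (-Real.sqrt (Real.pi * ‖Dσ‖ * k))) := by
          gcongr
      _ = CA j / ‖c j‖ * L ^ NA j * Real.exp (B + 1) *
          ((1 + Real.sqrt (Real.pi * ‖Dσ‖ * k)) ^ NA j *
            Real.exp (-Real.sqrt (Real.pi * ‖Dσ‖ * k))) := by ring
  have hbig : ∀ᶠ k : ℕ in atTop, (B + 1) ^ 2 ≤ Real.pi * ‖Dσ‖ * k ∧ (1 : ℝ) ≤ k :=
    ((tendsto_natCast_atTop_atTop.const_mul_atTop (mul_pos Real.pi_pos hDσpos)).eventually_ge_atTop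
      _).and (tendsto_natCast_atTop_atTop.eventually_ge_atTop 1)
  obtain ⟨k, hk, ⟨hkB2, hk1⟩⟩ := ((eventually_all.2 hsmall).and hbig).exists
  have hkB : 2 * B + 1 ≤ Real.pi * ‖Dσ‖ * k := by nlinarith
  have hk0 : (0 : ℝ) < k := by linarith
  -- ### the branch functions
  set E : (Fin s → ℂ) → ℂ := fun ζ =>
    ((βf (ℓ + ζ) - 1) / (2 * α)) ^ 2 - (g (ℓ + ζ) + 2 * Real.pi * I * σ * k) / α with hE
  set τ : (Fin s → ℂ) → ℂ := fun ζ => -((βf (ℓ + ζ) - 1) / (2 * α)) + (E ζ) ^ ((2 : ℂ)⁻¹) with hτ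
  set xf : (Fin s → ℂ) → (Fin s → ℂ) := fun ζ j => τ ζ + ℓ j + ζ j with hxf
  -- `E = 2πk Dσ + (bounded)`
  have hEsplit : ∀ ζ, E ζ = ((2 * Real.pi * k : ℝ) : ℂ) * Dσ +
      (((βf (ℓ + ζ) - 1) / (2 * α)) ^ 2 - g (ℓ + ζ) / α) := by
    intro ζ
    simp only [hE, hDσ]
    push_cast
    field_simp
    ring
  -- ### estimates on the unit polydisc
  have hest : ∀ ζ : Fin s → ℂ, ‖ζ‖ < 1 →
      E ζ ∈ slitPlane ∧ Real.sqrt (Real.pi * ‖Dσ‖ * k) - B - 1 ≤ (τ ζ).re ∧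
        ‖xf ζ‖ ≤ 2 + 3 * B + 2 * Real.sqrt ((2 * Real.pi * ‖Dσ‖ + 1) * k) - 1 := by
    intro ζ hζ
    obtain ⟨hb1, hb2, hb3⟩ := hB ζ hζ.le
    obtain ⟨hsq, hwre, hre2⟩ := principalSqrt_facts (E ζ)
    set w : ℂ := (E ζ) ^ ((2 : ℂ)⁻¹) with hw
    set R : ℂ := ((βf (ℓ + ζ) - 1) / (2 * α)) ^ 2 - g (ℓ + ζ) / α with hR
    have hRb : ‖R‖ ≤ B := hb2
    -- `‖E‖ + Re E ≥ 2πk(‖Dσ‖ + Re Dσ) - 2B ≥ 2πk‖Dσ‖ - 2B`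
    have hmain : 2 * Real.pi * k * ‖Dσ‖ - 2 * B ≤ ‖E ζ‖ + (E ζ).re := by
      rw [hEsplit ζ]
      have h1 : ‖((2 * Real.pi * k : ℝ) : ℂ) * Dσ + R‖ ≥ 2 * Real.pi * k * ‖Dσ‖ - ‖R‖ := by
        have := norm_sub_norm_le (((2 * Real.pi * k : ℝ) : ℂ) * Dσ) (-R)
        rw [sub_neg_eq_add, norm_neg, norm_mul, Complex.norm_real,
          Real.norm_of_nonneg (by positivity)] at this
        linarith
      have h2 : (((2 * Real.pi * k : ℝ) : ℂ) * Dσ + R).re = 2 * Real.pi * k * Dσ.re + R.re := by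
        rw [Complex.add_re, Complex.re_ofReal_mul]
      have h3 : -‖R‖ ≤ R.re := by
        have := Complex.abs_re_le_norm R; rw [abs_le] at this; exact this.1
      have h4 : 0 ≤ 2 * Real.pi * k * Dσ.re := by
        have : 0 ≤ Dσ.re := hσre; positivity
      rw [h2]; linarith
    have hEupp : ‖E ζ‖ ≤ 2 * Real.pi * k * ‖Dσ‖ + B := by
      rw [hEsplit ζ]
      refine (norm_add_le _ _).trans ?_
      rw [norm_mul, Complex.norm_real, Real.norm_of_nonneg (by positivity)]
      linarith
    have hpos : 0 < ‖E ζ‖ + (E ζ).re := by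
      have : 2 * B + 1 ≤ Real.pi * ‖Dσ‖ * k := hkB
      nlinarith
    have hslit : E ζ ∈ slitPlane := by
      rw [mem_slitPlane_iff]
      by_contra hcon
      rw [not_or, not_lt, not_ne_iff] at hcon
      obtain ⟨h1, h2⟩ := hcon
      have : |(E ζ).re| = ‖E ζ‖ := Complex.abs_re_eq_norm.mpr h2
      rw [← this, abs_of_nonpos h1] at hpos
      linarith
    refine ⟨hslit, ?_, ?_⟩
    · -- `Re τ ≥ Re w - B ≥ √(π‖Dσ‖k) - B - 1`
      have hw2 : Real.pi * ‖Dσ‖ * k - B ≤ w.re ^ 2 := by rw [hre2]; linarith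
      have hw3 : Real.sqrt (Real.pi * ‖Dσ‖ * k) - 1 ≤ w.re := by
        by_cases hcase : Real.pi * ‖Dσ‖ * k - B ≤ 0
        · exfalso
          have hP : 2 * B + 1 ≤ Real.pi * ‖Dσ‖ * k := hkB
          linarith
        · rw [not_le] at hcase
          have h1 : Real.sqrt (Real.pi * ‖Dσ‖ * k - B) ≤ w.re := by
            rw [← Real.sqrt_sq hwre]; exact Real.sqrt_le_sqrt hw2
          -- `√P - 1 ≤ √(P - B)` since `√P ≥ (B+1)/2` (`P ≥ (B+1)²`)
          have hP : 2 * B + 1 ≤ Real.pi * ‖Dσ‖ * k := hkB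
          have hsP : (B + 1) / 2 ≤ Real.sqrt (Real.pi * ‖Dσ‖ * k) := by
            rw [Real.le_sqrt (by positivity) (by positivity)]
            nlinarith [hkB2]
          have h2 : Real.sqrt (Real.pi * ‖Dσ‖ * k) - 1 ≤ Real.sqrt (Real.pi * ‖Dσ‖ * k - B) := by
            by_cases hneg : Real.sqrt (Real.pi * ‖Dσ‖ * k) - 1 ≤ 0
            · exact hneg.trans (Real.sqrt_nonneg _)
            · rw [not_le] at hneg
              rw [Real.le_sqrt hneg.le hcase.le]
              have hss : Real.sqrt (Real.pi * ‖Dσ‖ * k) ^ 2 = Real.pi * ‖Dσ‖ * k :=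
                Real.sq_sqrt (by positivity)
              nlinarith
          linarith
      have hτre : (τ ζ).re = -((βf (ℓ + ζ) - 1) / (2 * α)).re + w.re := by
        simp only [hτ, hw, Complex.add_re, Complex.neg_re]
      have h5 : -((βf (ℓ + ζ) - 1) / (2 * α)).re ≥ -B := by
        have := Complex.abs_re_le_norm ((βf (ℓ + ζ) - 1) / (2 * α))
        rw [abs_le] at this; linarith [this.2]
      rw [hτre]; linarith
    · -- size of `x(ζ)`: `‖τ‖ ≤ B + ‖w‖`, `‖w‖ = √‖E‖ ≤ √(2π‖Dσ‖k + B)`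
      have hwn : ‖w‖ ≤ Real.sqrt ((2 * Real.pi * ‖Dσ‖ + 1) * k) + B := by
        have h1 : ‖w‖ ^ 2 = ‖E ζ‖ := by rw [← norm_pow, hsq]
        have h2 : ‖w‖ ≤ Real.sqrt ‖E ζ‖ := by rw [← h1, Real.sqrt_sq (norm_nonneg _)]
        have h3 : Real.sqrt ‖E ζ‖ ≤ Real.sqrt ((2 * Real.pi * ‖Dσ‖ + 1) * k + B ^ 2 + 2 * B *
            Real.sqrt ((2 * Real.pi * ‖Dσ‖ + 1) * k)) := by
          refine Real.sqrt_le_sqrt (hEupp.trans ?_)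
          have := Real.sqrt_nonneg ((2 * Real.pi * ‖Dσ‖ + 1) * k)
          nlinarith
        have h4 : (2 * Real.pi * ‖Dσ‖ + 1) * k + B ^ 2 + 2 * B * Real.sqrt ((2 * Real.pi * ‖Dσ‖ + 1) * k)
            = (Real.sqrt ((2 * Real.pi * ‖Dσ‖ + 1) * k) + B) ^ 2 := by
          rw [add_sq, Real.sq_sqrt (by positivity)]; ring
        rw [h4, Real.sqrt_sq (by positivity)] at h3
        linarith
      have hτn : ‖τ ζ‖ ≤ 2 * B + Real.sqrt ((2 * Real.pi * ‖Dσ‖ + 1) * k) := by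
        calc ‖τ ζ‖ ≤ ‖-((βf (ℓ + ζ) - 1) / (2 * α))‖ + ‖w‖ := norm_add_le _ _
          _ ≤ B + (Real.sqrt ((2 * Real.pi * ‖Dσ‖ + 1) * k) + B) := by
              rw [norm_neg]; exact add_le_add hb1 hwn
          _ = _ := by ring
      rw [pi_norm_le_iff_of_nonneg (by
        have := Real.sqrt_nonneg ((2 * Real.pi * ‖Dσ‖ + 1) * k); linarith)]
      intro j
      show ‖τ ζ + ℓ j + ζ j‖ ≤ _
      have h6 : ‖ℓ j + ζ j‖ ≤ B := (norm_le_pi_norm (ℓ + ζ) j).trans hb3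
      calc ‖τ ζ + ℓ j + ζ j‖ = ‖τ ζ + (ℓ j + ζ j)‖ := by rw [add_assoc]
        _ ≤ ‖τ ζ‖ + ‖ℓ j + ζ j‖ := norm_add_le _ _
        _ ≤ _ := by have := Real.sqrt_nonneg ((2 * Real.pi * ‖Dσ‖ + 1) * k); linarith
  -- ### the key algebraic identity: `g(x(ζ)) = τ(ζ) - 2πiσk`
  have halg : ∀ ζ, g (xf ζ) = τ ζ - 2 * Real.pi * I * σ * k := by
    intro ζ
    obtain ⟨hsq, -, -⟩ := principalSqrt_facts (E ζ)
    -- `g(τ𝟙 + v) = α τ² + β(v) τ + g(v)` with `v = ℓ + ζ`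
    have hsum1 : ∑ i, a i * (τ ζ + ℓ i + ζ i) ^ 2 =
        α * τ ζ ^ 2 + (2 * ∑ i, a i * (ℓ i + ζ i)) * τ ζ + ∑ i, a i * (ℓ i + ζ i) ^ 2 := by
      rw [hαdef, Finset.sum_mul, Finset.mul_sum, Finset.sum_mul, ← Finset.sum_add_distrib,
        ← Finset.sum_add_distrib]
      exact Finset.sum_congr rfl fun i _ => by ring
    have hsum2 : ∑ i, b i * (τ ζ + ℓ i + ζ i) = (∑ i, b i) * τ ζ + ∑ i, b i * (ℓ i + ζ i) := by
      rw [Finset.sum_mul, ← Finset.sum_add_distrib]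
      exact Finset.sum_congr rfl fun i _ => by ring
    have hexp : g (xf ζ) = α * τ ζ ^ 2 + βf (ℓ + ζ) * τ ζ + g (ℓ + ζ) := by
      show (∑ i, a i * (τ ζ + ℓ i + ζ i) ^ 2 + ∑ i, b i * (τ ζ + ℓ i + ζ i) + c₀) =
        α * τ ζ ^ 2 + (2 * ∑ i, a i * (ℓ + ζ) i + ∑ i, b i) * τ ζ +
          (∑ i, a i * (ℓ + ζ) i ^ 2 + ∑ i, b i * (ℓ + ζ) i + c₀)
      simp only [Pi.add_apply]
      rw [hsum1, hsum2]
      ring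
    -- the quadratic relation
    set pp : ℂ := (βf (ℓ + ζ) - 1) / (2 * α) with hpp
    set qq : ℂ := (g (ℓ + ζ) + 2 * Real.pi * I * σ * k) / α with hqq
    have hEpq : E ζ = pp ^ 2 - qq := rfl
    have hτpq : τ ζ = -pp + (E ζ) ^ ((2 : ℂ)⁻¹) := rfl
    have hp' : βf (ℓ + ζ) - 1 = 2 * α * pp := by rw [hpp]; field_simp
    have hq' : g (ℓ + ζ) + 2 * Real.pi * I * σ * k = α * qq := by rw [hqq]; field_simp
    have hquad : α * τ ζ ^ 2 + (βf (ℓ + ζ) - 1) * τ ζ + (g (ℓ + ζ) + 2 * Real.pi * I * σ * k) = 0 := by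
      rw [hp', hq', hτpq]
      have : α * (-pp + (E ζ) ^ ((2 : ℂ)⁻¹)) ^ 2 + 2 * α * pp * (-pp + (E ζ) ^ ((2 : ℂ)⁻¹)) + α * qq =
          α * (((E ζ) ^ ((2 : ℂ)⁻¹)) ^ 2 - (pp ^ 2 - qq)) := by ring
      rw [this, hsq, hEpq, sub_self, mul_zero]
    linear_combination hexp + hquad
  -- ### the perturbation on the unit polydisc
  set G : Fin s → (Fin s → ℂ) → ℂ := fun j ζ => eval (xf ζ) (A j) * exp (-(τ ζ)) * (c j)⁻¹ with hG
  have hGdiff : ∀ j, DifferentiableOn ℂ (G j) (ball 0 1) := by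
    intro j
    have hβd : Differentiable ℂ fun ζ : Fin s → ℂ => (βf (ℓ + ζ) - 1) / (2 * α) := by
      simp only [hβf]; fun_prop
    have hEd : Differentiable ℂ E := by
      show Differentiable ℂ fun ζ =>
        ((βf (ℓ + ζ) - 1) / (2 * α)) ^ 2 - (g (ℓ + ζ) + 2 * Real.pi * I * σ * k) / α
      simp only [hβf, hgdef]; fun_prop
    have hτd : DifferentiableOn ℂ τ (ball 0 1) := by
      have h1 : DifferentiableOn ℂ (fun ζ => (E ζ) ^ ((2 : ℂ)⁻¹)) (ball 0 1) :=
        hEd.differentiableOn.cpow (differentiableOn_const _) fun ζ hζ =>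
          (hest ζ (by rwa [mem_ball, dist_zero_right] at hζ)).1
      show DifferentiableOn ℂ (fun ζ => -((βf (ℓ + ζ) - 1) / (2 * α)) + (E ζ) ^ ((2 : ℂ)⁻¹)) _
      exact hβd.neg.differentiableOn.add h1
    have hxd : DifferentiableOn ℂ xf (ball 0 1) := by
      refine differentiableOn_pi.2 fun j => ?_
      show DifferentiableOn ℂ (fun ζ => τ ζ + ℓ j + ζ j) _
      exact (hτd.add_const _).add (differentiable_apply j).differentiableOn
    show DifferentiableOn ℂ (fun ζ => eval (xf ζ) (A j) * exp (-(τ ζ)) * (c j)⁻¹) _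
    exact (((differentiable_mvPolynomial_eval (A j)).comp_differentiableOn hxd).mul
      hτd.neg.cexp).mul_const _
  have hGb : ∀ j, ∀ ζ ∈ ball (0 : Fin s → ℂ) 1, ‖G j ζ‖ ≤ 1 / (16 * ((s : ℝ) + 1)) := by
    intro j ζ hζ
    rw [mem_ball, dist_zero_right] at hζ
    obtain ⟨-, hre, hxn⟩ := hest ζ hζ
    have hcj : 0 < ‖c j‖ := norm_pos_iff.mpr (hc j)
    have hAx : ‖eval (xf ζ) (A j)‖ ≤
        CA j * (2 + 3 * B + 2 * Real.sqrt ((2 * Real.pi * ‖Dσ‖ + 1) * k)) ^ NA j := by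
      refine (hCNA j _).trans (mul_le_mul_of_nonneg_left ?_ (hCA j))
      exact pow_le_pow_left₀ (by positivity) (by linarith) _
    have hex : Real.exp (-(τ ζ).re) ≤ Real.exp (-(Real.sqrt (Real.pi * ‖Dσ‖ * k) - B - 1)) :=
      Real.exp_le_exp.mpr (by linarith)
    have hnorm : ‖G j ζ‖ = ‖eval (xf ζ) (A j)‖ * Real.exp (-(τ ζ).re) * ‖c j‖⁻¹ := by
      simp only [hG, norm_mul, norm_inv, Complex.norm_exp, Complex.neg_re]
    rw [hnorm]
    calc ‖eval (xf ζ) (A j)‖ * Real.exp (-(τ ζ).re) * ‖c j‖⁻¹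
        ≤ CA j * (2 + 3 * B + 2 * Real.sqrt ((2 * Real.pi * ‖Dσ‖ + 1) * k)) ^ NA j *
            Real.exp (-(Real.sqrt (Real.pi * ‖Dσ‖ * k) - B - 1)) * ‖c j‖⁻¹ :=
          mul_le_mul_of_nonneg_right (mul_le_mul hAx hex (Real.exp_pos _).le
            (mul_nonneg (hCA j) (pow_nonneg (by
              have := Real.sqrt_nonneg ((2 * Real.pi * ‖Dσ‖ + 1) * k); linarith) _)))
            (inv_nonneg.mpr (norm_nonneg _))
      _ = CA j / ‖c j‖ * (2 + 3 * B + 2 * Real.sqrt ((2 * Real.pi * ‖Dσ‖ + 1) * k)) ^ NA j *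
            Real.exp (-(Real.sqrt (Real.pi * ‖Dσ‖ * k) - B - 1)) := by ring
      _ ≤ _ := hk j
  obtain ⟨ζ, hζ, hfix⟩ := Literature.NumberTheory.Transcendental.ExpDominant.exists_exp_eq_one_add
    G hε.le (le_of_eq (by field_simp : (16 : ℝ) * ((s : ℝ) + 1) * (1 / (16 * ((s : ℝ) + 1))) = 1))
    hGdiff hGb
  refine ⟨xf ζ, fun j => ?_⟩
  have hk1' : exp (-(2 * Real.pi * I * σ * k)) = 1 := by
    rcases hσ with h | h
    · rw [h]
      have h2 := Complex.exp_int_mul_two_pi_mul_I (-(k : ℤ))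
      have h3 : ((-(k : ℤ) : ℤ) : ℂ) * (2 * Real.pi * I) = -(2 * Real.pi * I * ((1 : ℝ) : ℂ) * k) := by
        push_cast; ring
      rwa [h3] at h2
    · rw [h]
      have h2 := Complex.exp_int_mul_two_pi_mul_I (k : ℤ)
      have h3 : ((k : ℤ) : ℂ) * (2 * Real.pi * I) = -(2 * Real.pi * I * ((-1 : ℝ) : ℂ) * k) := by
        push_cast; ring
      rwa [h3] at h2
  have hgx : exp (∑ i, a i * xf ζ i ^ 2 + ∑ i, b i * xf ζ i + c₀) = exp (τ ζ) := by
    have : (∑ i, a i * xf ζ i ^ 2 + ∑ i, b i * xf ζ i + c₀) = g (xf ζ) := rfl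
    rw [this, halg, sub_eq_add_neg, Complex.exp_add, hk1', mul_one]
  rw [hgx]
  show exp (τ ζ + ℓ j + ζ j) = c j * exp (τ ζ) + eval (xf ζ) (A j)
  rw [Complex.exp_add, Complex.exp_add, hexpℓ j, hfix j]
  show exp (τ ζ) * c j * (1 + eval (xf ζ) (A j) * exp (-τ ζ) * (c j)⁻¹) =
    c j * exp (τ ζ) + eval (xf ζ) (A j)
  have hee : exp (τ ζ) * exp (-τ ζ) = 1 := by rw [← Complex.exp_add, add_neg_cancel, Complex.exp_zero]
  have hcj : c j ≠ 0 := hc j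
  have hmid : exp (τ ζ) * c j * (eval (xf ζ) (A j) * exp (-τ ζ) * (c j)⁻¹) = eval (xf ζ) (A j) := by
    calc exp (τ ζ) * c j * (eval (xf ζ) (A j) * exp (-τ ζ) * (c j)⁻¹)
        = eval (xf ζ) (A j) * (exp (τ ζ) * exp (-τ ζ)) * (c j * (c j)⁻¹) := by ring
      _ = eval (xf ζ) (A j) := by rw [hee, mul_inv_cancel₀ hcj]; ring
  rw [mul_add, mul_one, hmid]
  ring

/-- **The diagonal-quadric escape varieties meet the graph of exponentiation** (EC vocabulary): with
`n = s + 1`, for `Σᵢ aᵢ ≠ 0`, `cⱼ ≠ 0` and arbitrary `Aⱼ`, the subvariety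
`V = {xₙ = Σᵢ aᵢ xᵢ² + Σᵢ bᵢ xᵢ + c₀, yⱼ = cⱼ yₙ + Aⱼ(x') (j ≤ s)}` of `ℂⁿ × ℂⁿ` (distinguished last
coordinate `Fin.last s`) contains a point of `Literature.NumberTheory.Transcendental.expGraph ℂ n`. Its
additive projection is the quadric graph hypersurface (dimension `n - 1`); no condition on lattice
directions. [cite: MantovaMasser2023, §1 p.5 (the open case dim π(V) = 2 in ℂ³×ℂˣ³)] -/
theorem quadricEscape_inter_expGraph_nonempty {s : ℕ} (a b : Fin s → ℂ) (c₀ : ℂ)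
    (hα : ∑ i, a i ≠ 0) (c : Fin s → ℂ) (hc : ∀ j, c j ≠ 0) (A : Fin s → MvPolynomial (Fin s) ℂ) :
    ({z : Fin (s + 1) ⊕ Fin (s + 1) → ℂ |
        z (Sum.inl (Fin.last s)) = ∑ i, a i * z (Sum.inl (Fin.castSucc i)) ^ 2 +
          ∑ i, b i * z (Sum.inl (Fin.castSucc i)) + c₀ ∧
        ∀ j : Fin s, z (Sum.inr (Fin.castSucc j)) =
          c j * z (Sum.inr (Fin.last s)) + eval (fun i => z (Sum.inl (Fin.castSucc i))) (A j)} ∩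
      Literature.NumberTheory.Transcendental.expGraph ℂ (s + 1)).Nonempty := by
  obtain ⟨x, hx⟩ := exists_expPoint_quadricEscape a b c₀ hα c hc A
  set X : Fin (s + 1) → ℂ := Fin.snoc x (∑ i, a i * x i ^ 2 + ∑ i, b i * x i + c₀) with hX
  refine ⟨Sum.elim X fun i => exp (X i), ⟨?_, fun j => ?_⟩, fun i => ?_⟩
  · simp only [Sum.elim_inl, hX, Fin.snoc_last, Fin.snoc_castSucc]
  · simp only [Sum.elim_inl, Sum.elim_inr, hX, Fin.snoc_castSucc, Fin.snoc_last]
    exact hx j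
  · simp [Literature.ModelTheory.ExponentialFields.ExponentialRing.complex_exp_eq]

end Summit.Schanuel.Schanuel.Theorems
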